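import Summits.BirchSwinnertonDyer.BirchSwinnertonDyer.Theorems.ByReductionTypeAtTwoSupersingularFlatCountTwoOfPrintV7
import Summits.BirchSwinnertonDyer.BirchSwinnertonDyer.Theorems.ThetaPartnerAtTwoSignedControlAtTwoH1SigmaCorankBound
import HarnessLib

/-!
# COUNT♭@2 door v8 — from THREE named facts of Greenberg LNM 1716 / Kato (the corank bound pp. 119–120 is now a THEOREM)

Crux `SupersingularRankZeroAtTwo` (stmt-BirchSwinnertonDyer-19097, route `ByReductionTypeAtTwo`, line `flat_uniform_two`, conjunct
COUNT♭@2 of stub (2)); written by the K4 width seat `prover-bsd-wall-tp2-p3-w3` g4 (crux `SignedControlAtTwo`, 20309), whose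
`SignedEC.H1SigmaCorank.h1Sigma_zpCorank_le_degree_holds_rat : Greenberg1999.h1Sigma_zpCorank_le_degree ℚ`
(`…Theorems/ThetaPartnerAtTwoSignedControlAtTwoH1SigmaCorankBound.lean`) discharges the binder `hcork` of the bsd-2adic lane's door v7
`SSFlatEC.flatCountTwo_of_print4`. THIS FILE: door v8 `flatCountTwo_of_print3` = door v7 with `hcork` supplied by that theorem.
Displayed named facts: Prop. 4.13 (Cassels), Prop. 4.12, §5 p. 140 (Kato Thm. 12.4). Displayed residue: none. THEOREMS ONLY; closes
nothing by itself; BSD is not proved by any of this.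

References: [GreenbergLNM1716] §4 Prop. 4.12, Prop. 4.13 / p. 122, pp. 108, 119–120; §5 p. 140; [Kato2004Asterisque] Thm. 12.4;
[Sprung2012] §7.
-/

set_option autoImplicit false
-- the Theorems namespace of this sub repeats the summit name by design (D-0017 nested layout)
set_option linter.dupNamespace false

noncomputable section

open scoped Classical NumberField

open NumberField IsDedekindDomain WeierstrassCurve Literature.NumberTheory.EllipticCurves
  Literature.NumberTheory.GaloisRepresentations ZpExtension Literature.NumberTheory.EllipticCurves.Kobayashi2003
  Literature.NumberTheory.EllipticCurves.Sprung2017 Literature.NumberTheory.EllipticCurves.Sprung2012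
  Literature.NumberTheory.EllipticCurves.Sprung2024 Literature.NumberTheory.EllipticCurves.IwasawaDual
  Literature.NumberTheory.EllipticCurves.GreenbergVatsal2000 Literature.NumberTheory.EllipticCurves.Rank1Residual
  Summit.BirchSwinnertonDyer.Rank1Residual.X5.O1

namespace Summit.BirchSwinnertonDyer.BirchSwinnertonDyer.Theorems.SSFlatEC

/-- **DOOR v8 — COUNT♭@2 from THREE named facts of Greenberg LNM 1716 / Kato by name and the Honda₂ clauses alone.**
Door v7 (`flatCountTwo_of_print4`) with its binder `hcork : Greenberg1999.h1Sigma_zpCorank_le_degree ℚ` (pp. 119–120, the corank bound)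
supplied by the tree THEOREM `SignedEC.H1SigmaCorank.h1Sigma_zpCorank_le_degree_holds_rat`. Displayed named facts: Prop. 4.13 (Cassels),
Prop. 4.12, §5 p. 140 (Kato Thm. 12.4). Displayed residue: none.
[cite: GreenbergLNM1716, §4 Prop. 4.12, Prop. 4.13 / p. 122, pp. 108, 119–120; §5 p. 140]
[cite: Kato2004Asterisque, Thm. 12.4 (1)(2) p. 221] [cite: Sprung2012, §7 Def. 7.9–7.11 (p. 1503)] -/
theorem flatCountTwo_of_print3 (W : WeierstrassCurve ℚ) [W.IsElliptic] [W.IsGloballyMinimal]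
    (hss : GoodSS W 2) (κ : ZpExtension ℚ 2) (hκ : κ.IsCyclotomic) {γ : Field.absoluteGaloisGroup ℚ}
    (hγ : κ.IsTopGenerator γ) {v : HeightOneSpectrum (𝓞 ℚ)} (hv : (2 : 𝓞 ℚ) ∈ v.asIdeal)
    {g : Field.absoluteGaloisGroup (v.adicCompletion ℚ)} {c : ℕ → localPoints W (v.adicCompletion ℚ)}
    (hg : κ.IsTopGenerator (resGalOfEmb (closureEmb (K := ℚ) (v.adicCompletion ℚ)) g))
    (hc : ∀ n, c n ∈ localLayerPointsOfEmb κ (closureEmb (K := ℚ) (v.adicCompletion ℚ)) W n)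
    (hTr : ∀ n, 1 ≤ n → localTraceOfEmb κ (closureEmb (K := ℚ) (v.adicCompletion ℚ)) W n (n + 1)
      (c (n + 1)) = W.frobeniusTrace 2 • c n - c (n - 1))
    (hinj : ∀ z₀ : localLayerPointsOfEmb κ (closureEmb (K := ℚ) (v.adicCompletion ℚ)) W 0 →+ ℤ_[2],
      evalOn W (localLayerPointsOfEmb κ (closureEmb (K := ℚ) (v.adicCompletion ℚ)) W 0) z₀ (c 0) = 0 →
        z₀ = 0)
    (hsat : ∀ a : ℤ_[2],
      (∃ z₀ : localLayerPointsOfEmb κ (closureEmb (K := ℚ) (v.adicCompletion ℚ)) W 0 →+ ℤ_[2],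
        evalOn W (localLayerPointsOfEmb κ (closureEmb (K := ℚ) (v.adicCompletion ℚ)) W 0) z₀ (c 0) =
          2 * a) →
      ∃ y : localLayerPointsOfEmb κ (closureEmb (K := ℚ) (v.adicCompletion ℚ)) W 0 →+ ℤ_[2],
        evalOn W (localLayerPointsOfEmb κ (closureEmb (K := ℚ) (v.adicCompletion ℚ)) W 0) y (c 0) = a)
    (S₀ : Finset (HeightOneSpectrum (𝓞 ℚ)))
    (hgood : ∀ w : HeightOneSpectrum (𝓞 ℚ), w ∉ S₀ → ((2 : ℕ) : 𝓞 ℚ) ∉ w.asIdeal → W.HasGoodReductionAt w)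
    -- PRINT BY NAME (three named facts; pp. 108 and 119–120 are theorems of the tree)
    (hC : Greenberg1999.casselsSurjectivity_H1Sigma ℚ)
    (h412 : Greenberg1999.prop412_noFiniteSubmodule_H1Sigma_of_rank_one)
    (hWL : Greenberg1999.h1SigmaInfty_rank_eq_one) :
    Finite (W.selmerGroupPInfty 2) →
      Finite (EndCoinvariants (conjSharpFlatSelmerInfty W κ (closureEmb (K := ℚ) (v.adicCompletion ℚ))
        (W.frobeniusTrace 2) g c .flat γ - 1)) →
      Nat.card (↥((sharpFlatSelmerInfty W κ (closureEmb (K := ℚ) (v.adicCompletion ℚ))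
            (W.frobeniusTrace 2) g c .flat).comap (W.layerToInfty κ 0)) ⧸
          (W.selmerLayer κ 0).addSubgroupOf
            ((sharpFlatSelmerInfty W κ (closureEmb (K := ℚ) (v.adicCompletion ℚ))
              (W.frobeniusTrace 2) g c .flat).comap (W.layerToInfty κ 0))) *
        Nat.card (MulAction.fixedPoints (Field.absoluteGaloisGroup ℚ) (W.geomPrimaryTorsion 2)) =
      2 ^ (padicValNat 2 W.tamagawaProduct) *
        Nat.card (EndCoinvariants (conjSharpFlatSelmerInfty W κ
          (closureEmb (K := ℚ) (v.adicCompletion ℚ)) (W.frobeniusTrace 2) g c .flat γ - 1)) :=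
  flatCountTwo_of_print4 W hss κ hκ hγ hv hg hc hTr hinj hsat S₀ hgood hC h412
    SignedEC.H1SigmaCorank.h1Sigma_zpCorank_le_degree_holds_rat hWL

end Summit.BirchSwinnertonDyer.BirchSwinnertonDyer.Theorems.SSFlatEC

end
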